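import Mathlib

/-!
# (G♯) local engine — the odd-row lemma (planner qa-qnc0-p2 g24's `HOME/qa-qnc0-p2/line24/OddRow.lean`, sha16 `7fd99058826526ca`, VERBATIM)

Landed by qn-prover-3 g15 with the three `WalkTwoStepLocalEngine*.lean` files (ask P2-24b, `--supports stmt-QuantumAdvantage-23121`,
rung (G♯) `OddPrimeWalk.TwoStepFreeRungFive`).  Abstract combinatorial core of the block non-degeneracy lemma (N1) behind `DensePinned`
and of the non-vanishing of the flip-discordance behind `FarLocal` (ROUND-24 §1ter REVISION (g)).  WHAT THIS IS NOT: no statement about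
strategies; separation NOT moved.  The planner's module docstring follows.

# The odd-row lemma (combinatorial core of the block non-degeneracy (N1) and of `FarLocal`)

ROUND-24 §1ter REVISION (g).  In a mod-3 row of `ℤ_p × ℤ_3`, every co-observer term of the flip-discordance is supported on a set of EVEN
size (a consecutive pair of residues mod `p`, or nothing), while the flipped cut's own term is supported on a set of ODD size (`{a}` or all
of `ℤ_p`).  The XOR (symmetric difference) of an odd set with any number of even sets is odd, hence nonempty: the discordance is not
identically zero.  This file proves exactly that abstract statement (`odd_card_foldr_symmDiff`, `exists_mem_foldr_symmDiff`).
-/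

namespace Summit.QuantumAdvantage.AdviceFreeQNC0.LocalEngine.OddRow

open Finset
open scoped symmDiff

variable {X : Type*} [DecidableEq X]

/-- Parity of a symmetric difference: `|P ∆ R| + 2|P ∩ R| = |P| + |R|`. -/
theorem card_symmDiff_add (P R : Finset X) : (P ∆ R).card + 2 * (P ∩ R).card = P.card + R.card := by
  have h1 : (P \ R).card + (P ∩ R).card = P.card := Finset.card_sdiff_add_card_inter P R
  have h2 : (R \ P).card + (R ∩ P).card = R.card := Finset.card_sdiff_add_card_inter R P
  have h3 : (P ∆ R).card = (P \ R).card + (R \ P).card := by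
    rw [symmDiff_def, Finset.sup_eq_union, Finset.card_union_of_disjoint disjoint_sdiff_sdiff]
  rw [Finset.inter_comm R P] at h2
  omega

/-- An odd set XOR-ed with an even set stays odd. -/
theorem odd_card_symmDiff {P R : Finset X} (hP : Even P.card) (hR : Odd R.card) : Odd (P ∆ R).card := by
  have h := card_symmDiff_add P R
  rcases hP with ⟨k, hk⟩
  rcases hR with ⟨l, hl⟩
  refine ⟨k + l - (P ∩ R).card, ?_⟩
  omega

/-- **Odd-row lemma.**  Folding even sets into an odd set by symmetric difference leaves an odd set. -/
theorem odd_card_foldr_symmDiff (A₀ : Finset X) (hA : Odd A₀.card) (L : List (Finset X))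
    (hev : ∀ P ∈ L, Even P.card) : Odd (L.foldr (· ∆ ·) A₀).card := by
  induction L with
  | nil => simpa using hA
  | cons P L ih =>
    simp only [List.foldr_cons]
    exact odd_card_symmDiff (hev P (by simp)) (ih fun Q hQ => hev Q (by simp [hQ]))

/-- Hence the folded set is nonempty: some residue of the row is discordant. -/
theorem exists_mem_foldr_symmDiff (A₀ : Finset X) (hA : Odd A₀.card) (L : List (Finset X))
    (hev : ∀ P ∈ L, Even P.card) : ∃ x, x ∈ L.foldr (· ∆ ·) A₀ := by
  have h := odd_card_foldr_symmDiff A₀ hA L hev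
  by_contra hne
  push Not at hne
  have : L.foldr (· ∆ ·) A₀ = ∅ := Finset.eq_empty_of_forall_notMem hne
  rw [this, Finset.card_empty] at h
  exact (Nat.not_odd_iff_even.mpr (by decide)) h

/-- Membership in the fold is the XOR of the memberships (the dictionary to Boolean status parities). -/
theorem mem_foldr_symmDiff_iff (A₀ : Finset X) (L : List (Finset X)) (x : X) :
    x ∈ L.foldr (· ∆ ·) A₀ ↔
      (decide (x ∈ A₀) ^^ L.foldr (fun P acc => decide (x ∈ P) ^^ acc) false) = true := by
  induction L with
  | nil => simp
  | cons P L ih =>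
    simp only [List.foldr_cons, Finset.mem_symmDiff]
    by_cases hP : x ∈ P <;> by_cases hF : x ∈ L.foldr (· ∆ ·) A₀ <;>
      simp_all [Bool.xor_comm]

end Summit.QuantumAdvantage.AdviceFreeQNC0.LocalEngine.OddRow
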